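import Summits.QuantumFields.YangMills.Theorems.UnitScaleTiltCoverFlatH
import HarnessLib

/-!
# Route `UnitScaleTilt`, crux K1 child «MinimiserStabilityRegPr» (stmt-QuantumFields-19200), registered stub `stub_halvingStep` (H), branch (P2-small),
# mechanism of record **(α) COVERING ∕ PERIODISATION** (OWNER RULING g26-№18, ACK 31 (2)) — file `CoverFlatG`: **THE THIRD COVER IDENTITY `GE_cover` — THE GENUINE
# PROPAGATOR `G = Δ_a⁻¹` ((2.22)) WITH WEIGHTS `w′` DOWNSTAIRS ∕ `w′ ∘ projIdx` UPSTAIRS IS THE DESCENT OF THE COVER'S**, modulo the same four average identities as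
# ✓`CoverFlatH.flatH_cover_of` (for ★w7-19200 g0's (P-2) `gBand_of_adm22_allSizes` port)

Cell `ym3-torus` (HUMAN RULING D-0037, YM ladder rung R3 — continuum SU(2) YM₃ on the torus is a RUNG, not the Clay problem), width seat `ym-ust-20520-w1` gen 5.
`--supports stmt-QuantumFields-19200 --as helper`; def-free, 0 sorry, standard axioms.

* `GE_pull_proj` — ✓`CoverFlatOps.GE_intertwine` at the covering map with `hΔ :=` ✓`CoverFlatOps.deltaAE_pull` discharged as in ✓`CoverFlatH.hOp_pull_proj` (any weights);
* ★`GE_cover_of : GE (D.comap jc) hc (w := w′ ∘ projIdx) _ (toLp (f ∘ projBond)) bt = GE D hc (w := w′) hw′ (toLp f) (projBond bt)`;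
* ★`isFlatGW_cover_of` — the same for any two plain-function propagators pinned by ✓`FlatOpsLettersAssembly.IsFlatGW` (weights `w′`, `w′ ∘ projIdx`).
HONEST SCOPE: linear algebra; NOT a claim about the H stub, the crux, the rung or a mass gap.

References: T. Bałaban, CMP **96** (1984) 223–250 [Balaban1984PropagatorsII] (2.16) p.225, (2.19)–(2.22) p.226.
-/

set_option autoImplicit false

noncomputable section

open scoped BigOperators InnerProductSpace Classical

namespace Summit.QuantumFields.YangMills.Theorems.CoverFlatG

open Literature.MathematicalPhysics.QuantumFieldTheory.Balaban1983to89
open LatticeFieldCalculus (siteAvgIter bondAvgIter)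
open B6SectADomainsV1 (Domains)
open B6SectAOperatorsV1 (onE ScalarSpace SiteIdx BondIdx SiteIdxSpace BondIdxSpace)
open B6SectAVectorModelV1 (deltaAE GE)
open Literature.MathematicalPhysics.QuantumFieldTheory.BalabanImbrieJaffe1984to88.BIJ85AxialPropagator411 (BondSpace PlaqSpace)
open T3ContinuumYM3Torus (T3Family)
open CoverSites (cover proj projBond proj_shift_cast proj_unshift_cast)
open CoverDomains (projIdx lamSite_comap_iff)
open CoverPullback (adjoint_onE_funLeft_apply cover_d_eq)
open CoverFlatOps (GE_intertwine deltaAE_pull)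
open CoverFlatH (idxFibre_bijective sidxFibre_bijective)
open FlatOpsLettersAssembly (IsFlatGW)

section T3

variable (F : T3Family) (n K : ℕ) (jc : ℕ) (D : Domains (F.P K))

/-- `G = Δ_a⁻¹` intertwines with the bond pullback at the covering map, any weights (✓`GE_intertwine` + ✓`deltaAE_pull` discharged at `proj`).
[cite: Balaban1984PropagatorsII, (2.22) p.226] -/
theorem GE_pull_proj {c : ℝ} (hc : c ≠ 0) {w : BondIdx D → ℝ} (hw : ∀ i, 0 < w i)
    (hbpull : ∀ (A : VecField (F.P K) 0 ℝ) (k : ℕ), k ≤ (F.P K).m + (F.P K).K → ∀ ct : PBond (cover (F.P K) jc) k,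
      bondAvgIter k (fun b' : PBond (cover (F.P K) jc) 0 => A ⟨proj (F.P K) jc 0 b'.src, Fin.cast rfl b'.dir⟩) ct =
        bondAvgIter k A ⟨proj (F.P K) jc k ct.src, Fin.cast rfl ct.dir⟩)
    (hbpush : ∀ (g : VecField (cover (F.P K) jc) 0 ℝ) (k : ℕ), k ≤ (F.P K).m + (F.P K).K → ∀ (y : Site (F.P K) k) (μ : Fin (cover (F.P K) jc).d),
      bondAvgIter k (fun b : PBond (F.P K) 0 => ∑ b' : {b' : PBond (cover (F.P K) jc) 0 //
          (⟨proj (F.P K) jc 0 b'.src, Fin.cast rfl b'.dir⟩ : PBond (F.P K) 0) = b}, g b'.1) ⟨y, Fin.cast rfl μ⟩ =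
        ∑ y' : {y' : Site (cover (F.P K) jc) k // proj (F.P K) jc k y' = y}, bondAvgIter k g ⟨y'.1, μ⟩)
    (hspull : ∀ (f : SiteField (F.P K) 0 ℝ) (k : ℕ), k ≤ (F.P K).m + (F.P K).K →
      siteAvgIter k (f ∘ proj (F.P K) jc 0) = siteAvgIter k f ∘ proj (F.P K) jc k)
    (hspush : ∀ (g : SiteField (cover (F.P K) jc) 0 ℝ) (k : ℕ), k ≤ (F.P K).m + (F.P K).K → ∀ y : Site (F.P K) k,
      siteAvgIter k (fun x => ∑ x' : {x' : Site (cover (F.P K) jc) 0 // proj (F.P K) jc 0 x' = x}, g x'.1) y =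
        ∑ y' : {y' : Site (cover (F.P K) jc) k // proj (F.P K) jc k y' = y}, siteAvgIter k g y'.1)
    (u : BondSpace (F.P K)) :
    GE (D.comap jc) hc (w := w ∘ projIdx D jc) (fun i => hw (projIdx D jc i))
        (onE (LinearMap.funLeft ℝ ℝ (fun b' : PBond (cover (F.P K) jc) 0 => (⟨proj (F.P K) jc 0 b'.src, Fin.cast rfl b'.dir⟩ : PBond (F.P K) 0))) u) =
      onE (LinearMap.funLeft ℝ ℝ (fun b' : PBond (cover (F.P K) jc) 0 => (⟨proj (F.P K) jc 0 b'.src, Fin.cast rfl b'.dir⟩ : PBond (F.P K) 0)))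
        (GE D hc hw u) :=
  GE_intertwine D (D.comap jc) hc hw (fun i => hw (projIdx D jc i))
    (onE (LinearMap.funLeft ℝ ℝ (fun b' : PBond (cover (F.P K) jc) 0 => (⟨proj (F.P K) jc 0 b'.src, Fin.cast rfl b'.dir⟩ : PBond (F.P K) 0))))
    (deltaAE_pull (cover_d_eq (F.P K) jc) (proj (F.P K) jc 0) (proj_shift_cast (F.P K) jc 0 (cover_d_eq (F.P K) jc))
      (proj_unshift_cast (F.P K) jc 0 (cover_d_eq (F.P K) jc)) D (D.comap jc) (projIdx D jc)
      (fun st => ⟨⟨st.1.1, proj (F.P K) jc (st.1.1 : ℕ) st.1.2⟩, (lamSite_comap_iff D jc _ _).1 st.2⟩) c w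
      (LinearMap.adjoint (onE (LinearMap.funLeft ℝ ℝ (proj (F.P K) jc 0))))
      (LinearMap.adjoint (onE (LinearMap.funLeft ℝ ℝ (fun b' : PBond (cover (F.P K) jc) 0 => (⟨proj (F.P K) jc 0 b'.src, Fin.cast rfl b'.dir⟩ : PBond (F.P K) 0)))))
      (LinearMap.adjoint (onE (LinearMap.funLeft ℝ ℝ (fun p' : Plaq (cover (F.P K) jc) 0 =>
        (⟨proj (F.P K) jc 0 p'.src, Fin.cast rfl p'.μ, Fin.cast rfl p'.ν, Fin.lt_def.mpr (Fin.lt_def.mp p'.hμν)⟩ : Plaq (F.P K) 0)))))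
      (LinearMap.adjoint (onE (LinearMap.funLeft ℝ ℝ (projIdx D jc))))
      (LinearMap.adjoint (onE (LinearMap.funLeft ℝ ℝ
        (fun st : SiteIdx (D.comap jc) => (⟨⟨st.1.1, proj (F.P K) jc (st.1.1 : ℕ) st.1.2⟩, (lamSite_comap_iff D jc _ _).1 st.2⟩ : SiteIdx D)))))
      (fun g x => adjoint_onE_funLeft_apply _ g x) (fun g b => adjoint_onE_funLeft_apply _ g b) (fun g p => adjoint_onE_funLeft_apply _ g p)
      (fun g c' => adjoint_onE_funLeft_apply _ g c') (fun g s => adjoint_onE_funLeft_apply _ g s)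
      (fun A c' => (hbpull A _ (le_trans (Nat.lt_succ_iff.1 c'.1.1.isLt) D.hk) c'.1.2).symm)
      (fun g c' => (Fintype.sum_bijective _ (idxFibre_bijective D jc c') (fun yt => bondAvgIter (c'.1.1 : ℕ) g ⟨yt.1, c'.1.2.dir⟩)
          (fun ct => bondAvgIter (ct.1.1.1 : ℕ) g ct.1.1.2) (fun yt => rfl)).symm.trans
        (hbpush g _ (le_trans (Nat.lt_succ_iff.1 c'.1.1.isLt) D.hk) c'.1.2.src c'.1.2.dir).symm)
      (fun f s' => (congrFun (hspull f _ (le_trans (Nat.lt_succ_iff.1 s'.1.1.isLt) D.hk)) s'.1.2).symm)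
      (fun g s => by
        rw [hspush g _ (le_trans (Nat.lt_succ_iff.1 s.1.1.isLt) D.hk) s.1.2]
        exact (Fintype.sum_bijective _ (sidxFibre_bijective D jc s) _ _ fun yt => rfl).symm))
    u

/-- ★ **`GE_cover`** (modulo the four average identities): `G̃_{w′∘projIdx} (f ∘ projBond) b̃ = G_{w′} f (projBond b̃)` for the genuine propagators `G = Δ_a⁻¹`
(lattice factor `L^{K−n}`, the same on both lattices). [cite: Balaban1984PropagatorsII, (2.16) p.225, (2.22) p.226] -/
theorem GE_cover_of {w' : BondIdx D → ℝ} (hw' : ∀ i, 0 < w' i)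
    (hbpull : ∀ (A : VecField (F.P K) 0 ℝ) (k : ℕ), k ≤ (F.P K).m + (F.P K).K → ∀ ct : PBond (cover (F.P K) jc) k,
      bondAvgIter k (fun b' : PBond (cover (F.P K) jc) 0 => A ⟨proj (F.P K) jc 0 b'.src, Fin.cast rfl b'.dir⟩) ct =
        bondAvgIter k A ⟨proj (F.P K) jc k ct.src, Fin.cast rfl ct.dir⟩)
    (hbpush : ∀ (g : VecField (cover (F.P K) jc) 0 ℝ) (k : ℕ), k ≤ (F.P K).m + (F.P K).K → ∀ (y : Site (F.P K) k) (μ : Fin (cover (F.P K) jc).d),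
      bondAvgIter k (fun b : PBond (F.P K) 0 => ∑ b' : {b' : PBond (cover (F.P K) jc) 0 //
          (⟨proj (F.P K) jc 0 b'.src, Fin.cast rfl b'.dir⟩ : PBond (F.P K) 0) = b}, g b'.1) ⟨y, Fin.cast rfl μ⟩ =
        ∑ y' : {y' : Site (cover (F.P K) jc) k // proj (F.P K) jc k y' = y}, bondAvgIter k g ⟨y'.1, μ⟩)
    (hspull : ∀ (f : SiteField (F.P K) 0 ℝ) (k : ℕ), k ≤ (F.P K).m + (F.P K).K →
      siteAvgIter k (f ∘ proj (F.P K) jc 0) = siteAvgIter k f ∘ proj (F.P K) jc k)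
    (hspush : ∀ (g : SiteField (cover (F.P K) jc) 0 ℝ) (k : ℕ), k ≤ (F.P K).m + (F.P K).K → ∀ y : Site (F.P K) k,
      siteAvgIter k (fun x => ∑ x' : {x' : Site (cover (F.P K) jc) 0 // proj (F.P K) jc 0 x' = x}, g x'.1) y =
        ∑ y' : {y' : Site (cover (F.P K) jc) k // proj (F.P K) jc k y' = y}, siteAvgIter k g y'.1)
    (f : PBond (F.P K) 0 → ℝ) (bt : PBond (cover (F.P K) jc) 0) :
    GE (D.comap jc) (c := (F.L : ℝ) ^ (K - n)) (pow_ne_zero _ (Nat.cast_ne_zero.2 (F.P K).L_pos.ne')) (w := w' ∘ projIdx D jc)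
        (fun i => hw' (projIdx D jc i)) (WithLp.toLp 2 (fun b => f (projBond (F.P K) jc 0 b))) bt =
      GE D (c := (F.L : ℝ) ^ (K - n)) (pow_ne_zero _ (Nat.cast_ne_zero.2 (F.P K).L_pos.ne')) (w := w') hw' (WithLp.toLp 2 f) (projBond (F.P K) jc 0 bt) := by
  have h := GE_pull_proj F K jc D (c := (F.L : ℝ) ^ (K - n)) (pow_ne_zero _ (Nat.cast_ne_zero.2 (F.P K).L_pos.ne')) hw'
    hbpull hbpush hspull hspush (WithLp.toLp 2 f)
  exact congrArg (fun v : BondSpace (cover (F.P K) jc) => v bt) h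

/-- ★ **THE SAME FOR ANY TWO PLAIN-FUNCTION PROPAGATORS PINNED BY `IsFlatGW`** (weights `w′` on `D`, `w′ ∘ projIdx` on `D.comap jc`).
[cite: Balaban1984PropagatorsII, (2.16) p.225, (2.22) p.226] -/
theorem isFlatGW_cover_of {w' : BondIdx D → ℝ} (hw' : ∀ i, 0 < w' i)
    (hbpull : ∀ (A : VecField (F.P K) 0 ℝ) (k : ℕ), k ≤ (F.P K).m + (F.P K).K → ∀ ct : PBond (cover (F.P K) jc) k,
      bondAvgIter k (fun b' : PBond (cover (F.P K) jc) 0 => A ⟨proj (F.P K) jc 0 b'.src, Fin.cast rfl b'.dir⟩) ct =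
        bondAvgIter k A ⟨proj (F.P K) jc k ct.src, Fin.cast rfl ct.dir⟩)
    (hbpush : ∀ (g : VecField (cover (F.P K) jc) 0 ℝ) (k : ℕ), k ≤ (F.P K).m + (F.P K).K → ∀ (y : Site (F.P K) k) (μ : Fin (cover (F.P K) jc).d),
      bondAvgIter k (fun b : PBond (F.P K) 0 => ∑ b' : {b' : PBond (cover (F.P K) jc) 0 //
          (⟨proj (F.P K) jc 0 b'.src, Fin.cast rfl b'.dir⟩ : PBond (F.P K) 0) = b}, g b'.1) ⟨y, Fin.cast rfl μ⟩ =
        ∑ y' : {y' : Site (cover (F.P K) jc) k // proj (F.P K) jc k y' = y}, bondAvgIter k g ⟨y'.1, μ⟩)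
    (hspull : ∀ (f : SiteField (F.P K) 0 ℝ) (k : ℕ), k ≤ (F.P K).m + (F.P K).K →
      siteAvgIter k (f ∘ proj (F.P K) jc 0) = siteAvgIter k f ∘ proj (F.P K) jc k)
    (hspush : ∀ (g : SiteField (cover (F.P K) jc) 0 ℝ) (k : ℕ), k ≤ (F.P K).m + (F.P K).K → ∀ y : Site (F.P K) k,
      siteAvgIter k (fun x => ∑ x' : {x' : Site (cover (F.P K) jc) 0 // proj (F.P K) jc 0 x' = x}, g x'.1) y =
        ∑ y' : {y' : Site (cover (F.P K) jc) k // proj (F.P K) jc k y' = y}, siteAvgIter k g y'.1)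
    {G : (PBond (F.P K) 0 → ℝ) →ₗ[ℝ] (PBond (F.P K) 0 → ℝ)} {Gc : (PBond ((F.cover jc).P K) 0 → ℝ) →ₗ[ℝ] (PBond ((F.cover jc).P K) 0 → ℝ)}
    (hG : IsFlatGW F n K D hw' G) (hGc : IsFlatGW (F.cover jc) n K (D.comap jc) (w' := w' ∘ projIdx D jc) (fun i => hw' (projIdx D jc i)) Gc)
    (f : PBond (F.P K) 0 → ℝ) (bt : PBond (cover (F.P K) jc) 0) :
    Gc (fun b => f (projBond (F.P K) jc 0 b)) bt = G f (projBond (F.P K) jc 0 bt) := by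
  have e1 := hGc (fun b => f (projBond (F.P K) jc 0 b)) bt
  have e2 := hG f (projBond (F.P K) jc 0 bt)
  rw [e1, e2]
  exact GE_cover_of F n K jc D hw' hbpull hbpush hspull hspush f bt

end T3

end Summit.QuantumFields.YangMills.Theorems.CoverFlatG

end
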